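import Literature.Geometry.Kaehler.CyclotomicCMTypesDegreeLeEightAllPowersHodgeConjecture
import Literature.Geometry.Kaehler.ComplexTorusCMTypeModelsTwicePrimeDegreeHodgeClasses
import HarnessLib

/-!
# Cyclotomic fields of degree `≤ 10`: every abelian variety with complex multiplication by `ℚ(ζ_d)`, `φ(d) ≤ 10`, ANY CM type, satisfies the Hodge
# conjecture with all its powers; every complex torus with `P_u = Φ_d`, `φ(d) ≤ 10`, has `Hdg = Div` on all powers

Layer `Literature/Geometry/Kaehler`, namespace `Literature.Geometry.Kaehler.ComplexTorus`; lane `lit-hodgefound` (Track 2 foundations library),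
prover seat `lit-hodgefound-p10`, generation 33, row «A2-26(hr)» (self-proposed 2026-08-28) — the milestone statement of the generation.  Theorems
only; no `def`, no instance, no named fact (net Literature debt 0).

`φ(d) ≤ 10` and `d > 2` ⟹ `φ(d) ≤ 8` or `φ(d) = 10 = 2·5` (`φ` is even).  The first case is this generation's
`CyclotomicCMTypesDegreeLeEightAllPowersHodgeConjecture` (varieties) ∕ `ComplexTorusCyclotomicCharpolyHodgeClassesDegreeLeEight` (tori); the second is
the degree-`2ℓ` files (`Pohlmann1968/CMFieldTwicePrimeDegreeAllPowersHodgeConjecture`, `ComplexTorusCMTypeModelsTwicePrimeDegreeHodgeClasses`: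
Yanai–Tankeev–Ribet for the primitive types, `E^ℓ` for the others) with `ℓ = 5` (`d ∈ {11, 22}`).

* **`hodgeClassSpan_pow_eq_and_hodgeConjectureFor_pow_of_totient_le_ten`**: for `K = ℚ(ζ_d)`, `d > 2`, `φ(d) ≤ 10`, EVERY CM type `Φ`, every
  realisation `A`, every `n`: `B•(Aⁿ) ⊗ ℂ = D•(Aⁿ) ⊗ ℂ` and `HodgeConjectureFor (Aⁿ)`.
* **`divisorClasses_powPeriod_eq_hodgeClasses_of_charpoly_eq_cyclotomic_of_totient_le_ten`**: `Hdg(Xᵏ) = Div(Xᵏ)` for all `k`, for EVERY complex torus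
  with an endomorphism of characteristic polynomial `Φ_d`, `d > 2`, `φ(d) ≤ 10` (all `d ≤ 12` and `d ∈ {14, 15, 16, 18, 20, 22, 24, 30}`), and the
  dimension form `…_of_finrank_le_five` (complex tori of dimension `≤ 5`).

## References

* [Yanai1985] H. Yanai, J. Number Theory 21 (1985), §4 Theorem (p. 171).
* [Gordon1999HodgeAVSurvey] B. B. Gordon (1999), Thm. 6.3, Thm. 6.4, §9.3.
* [MoonenZarhin1999LowDim] B. Moonen, Yu. Zarhin, Math. Ann. 315 (1999), Thm. 0.1.
* [Dodson1984] B. Dodson, Trans. AMS 283 (1984), §3.3.2 Theorem p. 16.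
-/

noncomputable section

open scoped Classical nonZeroDivisors NumberField Manifold ContDiff MatrixGroups
open NumberField Module Polynomial CategoryTheory CategoryTheory.Limits

namespace Literature.Geometry.Kaehler

namespace ComplexTorus

-- `open scoped`: the tree's action of `Aut(ℂ)` on `Hom(K, ℂ)` by composition (`ringEquivCompAction`) is a scoped instance
open scoped Literature.NumberTheory.ComplexMultiplication
open Literature.AlgebraicGeometry.Motives (CMType AbelianVariety)
open Literature.AlgebraicGeometry.HodgeTheory (HodgeConjectureFor complexBetti)
open Literature.AlgebraicGeometry.VanGeemen1994 (hodgeClassSpan)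
open Literature.Barriers.HodgeConjecture (divisorClassesSpan)
open Literature.AlgebraicGeometry.ComplexMultiplication (IsCMTypeRealisation)
open Literature.AlgebraicGeometry.Pohlmann1968 (hodgeClassSpan_pow_eq_divisorClassesSpan_of_finrank_eq_two_mul_prime
  hodgeConjectureFor_pow_of_finrank_eq_two_mul_prime)
open Literature.AlgebraicGeometry.Pohlmann1968.Cyclotomic (finrank_eq_totient)

/-! ### §1 Varieties -/

section Varieties

variable {d : ℕ} {K : Type} [Field K] [NumberField K]
  {A : AbelianVariety ℂ} {ι : 𝓞 K →+* End A} {θ : K →+* Module.End ℂ (complexBetti A.X 1)}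

/-- **`B•(Aⁿ) ⊗ ℂ = D•(Aⁿ) ⊗ ℂ` AND THE HODGE CONJECTURE FOR EVERY POWER OF EVERY ABELIAN VARIETY WITH COMPLEX MULTIPLICATION BY A CYCLOTOMIC FIELD OF
DEGREE `≤ 10`, ANY CM TYPE** (`d > 2`, `φ(d) ≤ 10`). [cite: Gordon1999HodgeAVSurvey, Thm. 6.3, Thm. 6.4 and §9.3] [cite: Yanai1985, §4 Theorem (p. 171)]
[cite: Dodson1984, §3.3.2 Theorem (p. 16)] -/
theorem hodgeClassSpan_pow_eq_and_hodgeConjectureFor_pow_of_totient_le_ten (hK : IsCyclotomicExtension {d} ℚ K) (hd : 2 < d)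
    (h10 : Nat.totient d ≤ 10) (Φ : CMType K) (hA : IsCMTypeRealisation Φ A ι θ) (n k : ℕ) :
    hodgeClassSpan (⨁ fun _ : Fin n => A).dim (⨁ fun _ : Fin n => A).X k =
        divisorClassesSpan (⨁ fun _ : Fin n => A).X (⨁ fun _ : Fin n => A).dim k ∧
      HodgeConjectureFor (⨁ fun _ : Fin n => A).dim (⨁ fun _ : Fin n => A).X := by
  by_cases h8 : Nat.totient d ≤ 8
  · exact ⟨hodgeClassSpan_pow_eq_divisorClassesSpan_of_totient_le_eight hK hd h8 Φ hA n k,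
      hodgeConjectureFor_pow_of_totient_le_eight hK hd h8 Φ hA n⟩
  · have h10' : Nat.totient d = 2 * 5 := by
      obtain ⟨r, hr⟩ := Nat.totient_even hd
      omega
    haveI : NeZero d := ⟨by omega⟩
    haveI := hK
    haveI : IsCMField K := IsCyclotomicExtension.Rat.isCMField K (S := ({d} : Set ℕ)) ⟨d, rfl, hd⟩
    have hKd : finrank ℚ K = 2 * 5 := by rw [finrank_eq_totient d K, h10']
    exact ⟨hodgeClassSpan_pow_eq_divisorClassesSpan_of_finrank_eq_two_mul_prime (by norm_num) hKd Φ hA n k,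
      hodgeConjectureFor_pow_of_finrank_eq_two_mul_prime (by norm_num) hKd Φ hA n⟩

end Varieties

/-! ### §2 Complex tori with `P_u = Φ_d`, `φ(d) ≤ 10` -/

section Tori

variable {ι : Type} [Fintype ι] [DecidableEq ι] {E : Type} [NormedAddCommGroup E] [NormedSpace ℂ E]
  {P : (ι → ℝ) ≃L[ℝ] E} {d : ℕ}

/-- **`Hdg(Xᵏ) = Div(Xᵏ)` FOR ALL `k`, FOR EVERY COMPLEX TORUS WITH AN ENDOMORPHISM OF CHARACTERISTIC POLYNOMIAL `Φ_d`, `d > 2`, `φ(d) ≤ 10`**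
(simple or not; all `d ≤ 12` and `d ∈ {14, 15, 16, 18, 20, 22, 24, 30}`). [cite: MoonenZarhin1999LowDim, Thm. 0.1] [cite: Yanai1985, §4 Theorem (p. 171)]
[cite: Gordon1999HodgeAVSurvey, Thm. 6.3 (2), 7.5] [cite: Dodson1984, §3.3.2 Theorem (p. 16)] -/
theorem divisorClasses_powPeriod_eq_hodgeClasses_of_charpoly_eq_cyclotomic_of_totient_le_ten (hd : 2 < d) (h10 : Nat.totient d ≤ 10)
    {A : Matrix ι ι ℤ} (hA : A ∈ endRingInt P) (hP : A.charpoly = cyclotomic d ℤ) (k p : ℕ) :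
    divisorClasses (powPeriod P k) p = hodgeClasses (powPeriod P k) p := by
  by_cases h8 : Nat.totient d ≤ 8
  · exact divisorClasses_powPeriod_eq_hodgeClasses_of_charpoly_eq_cyclotomic_of_totient_le_eight hd hA hP h8 k p
  · have h10' : Nat.totient d = 2 * 5 := by
      obtain ⟨r, hr⟩ := Nat.totient_even hd
      omega
    exact divisorClasses_powPeriod_eq_hodgeClasses_of_charpoly_eq_cyclotomic_of_totient_eq_two_mul_prime hd (by norm_num) h10' hA hP k p

/-- **The same for complex tori of dimension `≤ 5`** (`2 dim X = φ(d)`) with an endomorphism of cyclotomic characteristic polynomial `Φ_d`, `d > 2`.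
[cite: MoonenZarhin1999LowDim, Thm. 0.1] [cite: Yanai1985, §4 Theorem (p. 171)] -/
theorem divisorClasses_powPeriod_eq_hodgeClasses_of_charpoly_eq_cyclotomic_of_finrank_le_five (hd : 2 < d) (h5 : finrank ℂ E ≤ 5)
    {A : Matrix ι ι ℤ} (hA : A ∈ endRingInt P) (hP : A.charpoly = cyclotomic d ℤ) (k p : ℕ) :
    divisorClasses (powPeriod P k) p = hodgeClasses (powPeriod P k) p := by
  have h := two_mul_finrank_eq_totient_of_charpoly_eq_cyclotomic P hP
  exact divisorClasses_powPeriod_eq_hodgeClasses_of_charpoly_eq_cyclotomic_of_totient_le_ten hd (by omega) hA hP k p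

end Tori

end ComplexTorus

end Literature.Geometry.Kaehler

end
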